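import Summits.QuantumFields.YangMills.Theorems.LuscherReductionDressedRitzPolyakovLiftTransplantReflect
import Summits.QuantumFields.YangMills.Theorems.LuscherReductionDressedRitzPolyakovLiftStaticsOfSeparationInstances
import HarnessLib

/-!
# Line «polyakovlift» r6/r7 on crux `DressedRitz` (stmt-QuantumFields-20205): S-STAT (o2) inside DEGENERATE multiplets — the r5 «symmetric multiplet» certificate
# (clause (c) of `PairSeparated`) transfers to transplant bases, because the transplant map `E ↦ (χ_R·E/f_0) ∘ rootCoord` is LINEAR and equivariant

Fleet-service module of seat ym-infvol-p1 g7.  The ∀-basis quantifier of the statics stub ranges, inside a degenerate level of `𝔥`, over EVERY orthonormal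
recombination `f_{i+1} = Σ_a p_a E_a`, `f_{l+1} = Σ_a q_a E_a` (`p ⊥ q`) of a fixed multiplet `E_1, …, E_n`; single parities do not separate such pairs, but
r5's clause (c) does (`dressed_pair_eq_zero_of_pairSeparated`, p545957: scalar Gram blocks on a symmetric multiplet).  This file supplies clause (c) for
transplant bases from FLAT data:

* `isPhys_flatTransplant` — `U ↦ χ_R(y)·E(y)/f_0(y)`, `y = rootCoord L μ U`, is physical for continuous colour-invariant `E` (`f_0 > 0` continuous invariant);
* `flatTransplant_comp_of_equivariant` — `σ` acting on the chart by a norm-preserving `S` with `f_0∘S = f_0`, `E∘S = ε E` ⇒ the pull-back picks up `ε`;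
* ★★ `pairSeparated_transplantObsL_of_multiplet` — if `f_{i+1} = Σ p_a E_a`, `f_{l+1} = Σ q_a E_a` with `Σ p_a q_a = 0` for a flat multiplet `E` that is PAIRWISE
  sign-separated by chart-equivariant involutive lift symmetries (`σ_{ab}`, `S_{ab}`) and TRANSITIVELY related to `E_{a₀}` by chart-equivariant lift symmetries
  (`τ_a`, `T_a`, sign `ε_a`), then `PairSeparated (g_i) (g_l)` — for EVERY rotation `(p, q)` of the basis inside the multiplet.

§3 (clause (b)): ★★ `pairSeparated_transplantObsL_of_twirl` (weighted twirls over chart-equivariant lift symmetries — isotypic / row projectors of a finite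
symmetry group — transfer from FLAT twirl identities) and ★★ `pairSeparated_transplantObsL_of_S3Twirl` (axis permutations; covers rotation pairs inside `E` doublets
and `A₁` against zero-`S₃`-average channels).

The chart-equivariant symmetries available in the tree: axis transpositions (`rootCoord_configPerm`), axis reflections (`rootCoord_axisReflect`), parity
(`rootCoord_linkInv`), with `f_0` invariant under each (`groundState_rowPerm/_rowNeg/_neg`).  HONEST FRAMING: bookkeeping on the conditional femto rung R2b1; which
levels of `𝔥` carry such multiplets is an open ONE-type classification; not infinite volume, not a gap, not Clay.
References: M. Lüscher, NPB 219 (1983) 233 [cite: Luscher1983, §2–§3]; M. Lüscher, U. Wolff, NPB 339 (1990) 222 [cite: LuscherWolff1990].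
-/

set_option autoImplicit false

noncomputable section

open MeasureTheory Filter Topology Real
open Literature.MathematicalPhysics.QuantumFieldTheory (GaugeConfig Site gaugeTransform configPerm)
open Literature.Analysis.OperatorTheory.YMMatrixModel
open scoped BigOperators

namespace Summit.QuantumFields.YangMills.Theorems.FemtoTransferGap.PolyakovLift

open Summit.QuantumFields.YangMills.Theorems.FemtoTransferGap

variable {k : ℕ}

/-- The flat transplant `U ↦ χ_R(y)·E(y)/f_0(y)` (`y = rootCoord L μ U`) of a continuous colour-invariant `E` is a physical one-site function (`f_0 > 0` continuous,
colour-invariant). [cite: Luscher1983, §2–§3] -/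
theorem isPhys_flatTransplant (L : ℕ) (μ : ℝ) {R : ℝ} (hR : 0 < R) {E f0 : ZM → ℝ} (hEc : Continuous E) (hEinv : IsGaugeInv E)
    (h0c : Continuous f0) (h0inv : IsGaugeInv f0) (h0pos : ∀ x, 0 < f0 x) :
    IsPhys (fun U : Cfg => radialCutoff R (rootCoord L μ U) * (E (rootCoord L μ U) / f0 (rootCoord L μ U))) := by
  have hc : Continuous fun y : ZM => radialCutoff R y * (E y / f0 y) :=
    ((radialCutoff_contDiff R (n := 0)).continuous).mul (hEc.div h0c fun x => (h0pos x).ne')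
  have hsupp : HasCompactSupport fun y : ZM => radialCutoff R y * (E y / f0 y) := (radialCutoff_hasCompactSupport hR).mul_right
  obtain ⟨C, hC⟩ := (hc.norm).bddAbove_range_of_hasCompactSupport hsupp.norm
  refine isPhys_rootPullback (G := fun y : ZM => radialCutoff R y * (E y / f0 y)) hc.measurable
    ⟨C, fun y => by have h := hC (Set.mem_range_self y); rwa [Real.norm_eq_abs] at h⟩ (fun M hM y => ?_) L μ
  simp only [isGaugeInv_radialCutoff R M hM y, hEinv M hM y, h0inv M hM y]

/-- Equivariant transfer for flat transplants: `σ` acts on the chart by a norm-preserving `S` with `f_0 ∘ S = f_0` and `E₁ ∘ S = ε·E₂` ⇒ the pull-backs satisfy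
`e₁ ∘ σ = ε·e₂` (one function: `E₁ = E₂`; a multiplet partner: `E₁ = E_{a₀}`, `E₂ = E_a`). [cite: Luscher1983, §2–§3] -/
theorem flatTransplant_comp_of_equivariant {L : ℕ} {μ R : ℝ} (E₁ E₂ f0 : ZM → ℝ) {σ : Cfg → Cfg} {S : ZM → ZM}
    (hS : ∀ U, rootCoord L μ (σ U) = S (rootCoord L μ U)) (hnorm : ∀ y, ‖S y‖ = ‖y‖) (h0 : ∀ y, f0 (S y) = f0 y)
    {ε : ℝ} (hE : ∀ y, E₁ (S y) = ε * E₂ y) (U : Cfg) :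
    radialCutoff R (rootCoord L μ (σ U)) * (E₁ (rootCoord L μ (σ U)) / f0 (rootCoord L μ (σ U))) =
      ε * (radialCutoff R (rootCoord L μ U) * (E₂ (rootCoord L μ U) / f0 (rootCoord L μ U))) := by
  rw [hS, radialCutoff_of_norm_eq R (hnorm _), h0, hE]
  ring

/-- The transplant map is linear in the numerator: `g_i = Σ_a p_a e_a` when `f_{i+1} = Σ_a p_a E_a`. [folklore] -/
theorem transplantObsL_eq_sum_of_eq_sum {L : ℕ} {Λ R : ℝ} {f : Fin (k + 1) → ZM → ℝ} {i : Fin k} {n : ℕ} {E : Fin n → ZM → ℝ} {p : Fin n → ℝ}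
    (hfi : ∀ y, f i.succ y = ∑ a, p a * E a y) (U : Cfg) :
    transplantObsL L Λ R f i U =
      ∑ a, p a * (radialCutoff R (rootCoord L (Λ / 2) U) * (E a (rootCoord L (Λ / 2) U) / f 0 (rootCoord L (Λ / 2) U))) := by
  show radialCutoff R (rootCoord L (Λ / 2) U) * (f i.succ (rootCoord L (Λ / 2) U) / f 0 (rootCoord L (Λ / 2) U)) = _
  rw [hfi, Finset.sum_div, Finset.mul_sum]
  exact Finset.sum_congr rfl fun a _ => by ring

/-- ★★ **Symmetric multiplets transfer: clause (c) of `PairSeparated` for transplant bases.**  Let `E : Fin n → ZM → ℝ` be continuous colour-invariant flat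
functions, pairwise separated by chart-equivariant involutive lift symmetries `σ_{ab}` (`E_a` even, `E_b` odd under `S_{ab}`, `f_0 ∘ S_{ab} = f_0`) and transitively
related to `E_{a₀}` by chart-equivariant lift symmetries `τ_a` (`E_{a₀} ∘ T_a = ε_a E_a`, `ε_a² = 1`, `f_0 ∘ T_a = f_0`).  If `f_{i+1} = Σ p_a E_a` and
`f_{l+1} = Σ q_a E_a` with `Σ p_a q_a = 0`, then `PairSeparated (g_i) (g_l)` for the transplant basis of `f` — for EVERY such rotation `(p, q)`.
[cite: Luscher1983, §2–§3] [cite: LuscherWolff1990] -/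
theorem pairSeparated_transplantObsL_of_multiplet (L : ℕ) {Λ R : ℝ} (hR : 0 < R) {f : Fin (k + 1) → ZM → ℝ} (hf : IsEigenFamily k f)
    (hpos : ∀ x, 0 < f 0 x) {n : ℕ} (E : Fin n → ZM → ℝ) (hEc : ∀ a, Continuous (E a)) (hEinv : ∀ a, IsGaugeInv (E a)) (a₀ : Fin n)
    (σ : Fin n → Fin n → Cfg → Cfg) (S : Fin n → Fin n → ZM → ZM) (τ : Fin n → Cfg → Cfg) (T : Fin n → ZM → ZM)
    (hσ : ∀ a b, a ≠ b → IsLiftSymmetry (σ a b) ∧ (∀ V, σ a b (σ a b V) = V) ∧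
      (∀ U, rootCoord L (Λ / 2) (σ a b U) = S a b (rootCoord L (Λ / 2) U)) ∧ (∀ y, ‖S a b y‖ = ‖y‖) ∧ (∀ y, f 0 (S a b y) = f 0 y) ∧
      (∀ y, E a (S a b y) = E a y) ∧ (∀ y, E b (S a b y) = -E b y))
    (hτ : ∀ a, IsLiftSymmetry (τ a) ∧ (∀ U, rootCoord L (Λ / 2) (τ a U) = T a (rootCoord L (Λ / 2) U)) ∧ (∀ y, ‖T a y‖ = ‖y‖) ∧
      (∀ y, f 0 (T a y) = f 0 y) ∧ ∃ ε : ℝ, ε ^ 2 = 1 ∧ ∀ y, E a₀ (T a y) = ε * E a y)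
    {i l : Fin k} (p q : Fin n → ℝ) (hpq : ∑ a, p a * q a = 0)
    (hfi : ∀ y, f i.succ y = ∑ a, p a * E a y) (hfl : ∀ y, f l.succ y = ∑ a, q a * E a y) :
    PairSeparated (transplantObsL L Λ R f i) (transplantObsL L Λ R f l) := by
  have h0c : Continuous (f 0) := (hf.1 0 0).continuous
  -- the transplanted multiplet
  set e : Fin n → (Cfg → ℝ) := fun a U =>
    radialCutoff R (rootCoord L (Λ / 2) U) * (E a (rootCoord L (Λ / 2) U) / f 0 (rootCoord L (Λ / 2) U)) with he
  refine Or.inr (Or.inr ⟨n, e, a₀, σ, τ, p, q, fun a => ?_, fun a b hab => ?_, fun a => ?_, hpq, fun V => ?_, fun V => ?_⟩)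
  · exact isPhys_flatTransplant L (Λ / 2) hR (hEc a) (hEinv a) h0c (hf.2.1 0) hpos
  · obtain ⟨hlift, hinv, hS, hnorm, h0, hEa, hEb⟩ := hσ a b hab
    refine ⟨hlift, hinv, fun V => ?_, fun V => ?_⟩
    · have h := flatTransplant_comp_of_equivariant (R := R) (E a) (E a) (f 0) hS hnorm h0 (ε := 1)
        (fun y => by rw [hEa y, one_mul]) V
      rw [one_mul] at h
      exact h
    · have h := flatTransplant_comp_of_equivariant (R := R) (E b) (E b) (f 0) hS hnorm h0 (ε := -1)
        (fun y => by rw [hEb y, neg_one_mul]) V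
      rw [neg_one_mul] at h
      exact h
  · obtain ⟨hlift, hT, hnorm, h0, ε, hε, hEε⟩ := hτ a
    refine ⟨hlift, ε, hε, fun V => ?_⟩
    exact flatTransplant_comp_of_equivariant (R := R) (E a₀) (E a) (f 0) hT hnorm h0 (ε := ε) hEε V
  · exact transplantObsL_eq_sum_of_eq_sum hfi V
  · exact transplantObsL_eq_sum_of_eq_sum hfl V

/-- ★★ **Hyperoctahedral multiplets of `𝔥` transfer.**  Let `E : Fin n → ZM → ℝ` be continuous colour-invariant flat partners such that every pair `a ≠ b` is
separated by SOME axis reflection `x_κ ↦ −x_κ` (`E_a` even, `E_b` odd) and every `E_a` is the image of `E_{a₀}` under SOME axis permutation `perm a` up to a sign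
(`E_{a₀} ∘ P_{perm a} = ε_a E_a`, `ε_a² = 1`) — e.g. the vector triplet (`κ a b = b`, `perm a = (a₀ a)`) or the `x_b x_c`-type triplet (`κ a b = a`).  Then for an AL1 family
with `f_0 > 0` whose channels `i ≠ l` are ANY orthogonal recombinations `f_{i+1} = Σ p_a E_a`, `f_{l+1} = Σ q_a E_a` (`Σ p_a q_a = 0`), the transplanted pair is
`PairSeparated` (clause (c)). [cite: Luscher1983, §2–§3] [cite: LuscherWolff1990] -/
theorem pairSeparated_transplantObsL_of_axisMultiplet (L : ℕ) {Λ R : ℝ} (hR : 0 < R) {f : Fin (k + 1) → ZM → ℝ} (hf : IsEigenFamily k f)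
    (hpos : ∀ x, 0 < f 0 x) {n : ℕ} (E : Fin n → ZM → ℝ) (hEc : ∀ a, Continuous (E a)) (hEinv : ∀ a, IsGaugeInv (E a)) (a₀ : Fin n)
    (κ : Fin n → Fin n → Fin 3) (perm : Fin n → Equiv.Perm (Fin 3))
    (hrefl : ∀ a b, a ≠ b →
      (∀ y, E a (LinearIsometryEquiv.piLpCongrRight 2
          (fun q : Fin 3 × Fin 3 => if q.1 = κ a b then LinearIsometryEquiv.neg ℝ (E := ℝ) else LinearIsometryEquiv.refl ℝ ℝ) y) = E a y) ∧
      (∀ y, E b (LinearIsometryEquiv.piLpCongrRight 2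
          (fun q : Fin 3 × Fin 3 => if q.1 = κ a b then LinearIsometryEquiv.neg ℝ (E := ℝ) else LinearIsometryEquiv.refl ℝ ℝ) y) = -E b y))
    (hperm : ∀ a, ∃ ε : ℝ, ε ^ 2 = 1 ∧
      ∀ y, E a₀ (LinearIsometryEquiv.piLpCongrLeft 2 ℝ ℝ ((perm a).prodCongr (Equiv.refl (Fin 3))) y) = ε * E a y)
    {i l : Fin k} (p q : Fin n → ℝ) (hpq : ∑ a, p a * q a = 0)
    (hfi : ∀ y, f i.succ y = ∑ a, p a * E a y) (hfl : ∀ y, f l.succ y = ∑ a, q a * E a y) :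
    PairSeparated (transplantObsL L Λ R f i) (transplantObsL L Λ R f l) := by
  refine pairSeparated_transplantObsL_of_multiplet L hR hf hpos E hEc hEinv a₀
    (fun a b V => configPerm (Equiv.swap 0 (κ a b)) ((configPerm (Equiv.swap 0 (κ a b)) V).negReflect))
    (fun a b => LinearIsometryEquiv.piLpCongrRight 2
      (fun q : Fin 3 × Fin 3 => if q.1 = κ a b then LinearIsometryEquiv.neg ℝ (E := ℝ) else LinearIsometryEquiv.refl ℝ ℝ))
    (fun a V => configPerm (perm a) V) (fun a => LinearIsometryEquiv.piLpCongrLeft 2 ℝ ℝ ((perm a).prodCongr (Equiv.refl (Fin 3))))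
    (fun a b hab => ⟨isLiftSymmetry_axisReflect (κ a b), axisReflect_involutive (κ a b), fun U => rootCoord_axisReflect L (Λ / 2) (κ a b) U,
      fun y => LinearIsometryEquiv.norm_map _ y, fun y => groundState_rowNeg_of_isEigenFamily hf hpos (κ a b) y, (hrefl a b hab).1, (hrefl a b hab).2⟩)
    (fun a => ⟨isLiftSymmetry_configPerm (perm a), fun U => rootCoord_configPerm L (Λ / 2) (perm a) U, fun y => LinearIsometryEquiv.norm_map _ y,
      fun y => groundState_rowPerm_of_isEigenFamily hf hpos (perm a) y, hperm a⟩)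
    p q hpq hfi hfl

/-! ## §3 Twirls transfer: clause (b) of `PairSeparated` for transplant bases (isotypic / row projectors of a finite symmetry group) -/

/-- The value of a transplant at a chart-equivariant symmetric image: `g_i (σ U) = χ_R(y)·f_{i+1}(S y)/f_0(y)`, `y = rootCoord U`. [cite: Luscher1983, §2–§3] -/
theorem transplantObsL_apply_of_equivariant {L : ℕ} {Λ R : ℝ} {f : Fin (k + 1) → ZM → ℝ} {σ : Cfg → Cfg} {S : ZM → ZM}
    (hS : ∀ U, rootCoord L (Λ / 2) (σ U) = S (rootCoord L (Λ / 2) U)) (hnorm : ∀ y, ‖S y‖ = ‖y‖) (h0 : ∀ y, f 0 (S y) = f 0 y)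
    (i : Fin k) (U : Cfg) :
    transplantObsL L Λ R f i (σ U) =
      radialCutoff R (rootCoord L (Λ / 2) U) * (f i.succ (S (rootCoord L (Λ / 2) U)) / f 0 (rootCoord L (Λ / 2) U)) := by
  show radialCutoff R (rootCoord L (Λ / 2) (σ U)) * (f i.succ (rootCoord L (Λ / 2) (σ U)) / f 0 (rootCoord L (Λ / 2) (σ U))) = _
  rw [hS, radialCutoff_of_norm_eq R (hnorm _), h0]

/-- A weighted twirl of a transplant over chart-equivariant symmetries is the transplant-shaped pull-back of the FLAT twirl:
`Σ_j w_j g_i(γ_j U) = χ_R(y)·(Σ_j w_j f_{i+1}(G_j y))/f_0(y)`. [cite: Luscher1983, §2–§3] -/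
theorem sum_mul_transplantObsL_of_equivariant {L : ℕ} {Λ R : ℝ} {f : Fin (k + 1) → ZM → ℝ} {J : Type} [Fintype J]
    {γ : J → Cfg → Cfg} {G : J → ZM → ZM} (w : J → ℝ)
    (hG : ∀ j U, rootCoord L (Λ / 2) (γ j U) = G j (rootCoord L (Λ / 2) U)) (hnorm : ∀ j y, ‖G j y‖ = ‖y‖) (h0 : ∀ j y, f 0 (G j y) = f 0 y)
    (i : Fin k) (U : Cfg) :
    ∑ j, w j * transplantObsL L Λ R f i (γ j U) =
      radialCutoff R (rootCoord L (Λ / 2) U) * ((∑ j, w j * f i.succ (G j (rootCoord L (Λ / 2) U))) / f 0 (rootCoord L (Λ / 2) U)) := by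
  rw [Finset.sum_div, Finset.mul_sum]
  refine Finset.sum_congr rfl fun j _ => ?_
  rw [transplantObsL_apply_of_equivariant (hG j) (hnorm j) (h0 j) i U]
  ring

/-- ★★ **Twirls transfer: clause (b) of `PairSeparated` for transplant bases.**  Let `γ_j` (`j ∈ J` finite) be lift symmetries acting on the chart by norm-preserving
`G_j` with `f_0 ∘ G_j = f_0`, paired by an involution `ι` (`γ_j ∘ γ_{ι j} = id`) with `ι`-symmetric weights `w`.  If the FLAT twirl `Σ_j w_j f_{i+1}(G_j y)` reproduces
`f_{i+1}` and kills `f_{l+1}` (or vice versa) — e.g. `w_j = (d/|J|)·⟨p, D(j) p⟩/‖p‖²` for a rotation pair `p ⊥ q` inside ONE irreducible multiplet `D`, or an isotypic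
projector for different isotypes — then `PairSeparated (g_i) (g_l)`. [cite: Luscher1983, §2–§3] [cite: LuscherWolff1990] -/
theorem pairSeparated_transplantObsL_of_twirl (L : ℕ) (Λ R : ℝ) {f : Fin (k + 1) → ZM → ℝ} {J : Type} [Fintype J]
    (γ : J → Cfg → Cfg) (G : J → ZM → ZM) (ι : J ≃ J) (w : J → ℝ)
    (hγ : ∀ j, IsLiftSymmetry (γ j)) (hγι : ∀ j V, γ j (γ (ι j) V) = V) (hw : ∀ j, w (ι j) = w j)
    (hG : ∀ j U, rootCoord L (Λ / 2) (γ j U) = G j (rootCoord L (Λ / 2) U)) (hnorm : ∀ j y, ‖G j y‖ = ‖y‖) (h0 : ∀ j y, f 0 (G j y) = f 0 y)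
    {i l : Fin k}
    (havg : ((∀ y, ∑ j, w j * f i.succ (G j y) = f i.succ y) ∧ (∀ y, ∑ j, w j * f l.succ (G j y) = 0)) ∨
      ((∀ y, ∑ j, w j * f l.succ (G j y) = f l.succ y) ∧ (∀ y, ∑ j, w j * f i.succ (G j y) = 0))) :
    PairSeparated (transplantObsL L Λ R f i) (transplantObsL L Λ R f l) := by
  refine Or.inr (Or.inl ⟨J, inferInstance, γ, ι, w, hγ, hγι, hw, ?_⟩)
  rcases havg with ⟨hfix, hkill⟩ | ⟨hfix, hkill⟩
  · refine Or.inl ⟨fun V => ?_, fun V => ?_⟩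
    · rw [sum_mul_transplantObsL_of_equivariant w hG hnorm h0 i V, hfix]; rfl
    · rw [sum_mul_transplantObsL_of_equivariant w hG hnorm h0 l V, hkill, zero_div, mul_zero]
  · refine Or.inr ⟨fun V => ?_, fun V => ?_⟩
    · rw [sum_mul_transplantObsL_of_equivariant w hG hnorm h0 l V, hfix]; rfl
    · rw [sum_mul_transplantObsL_of_equivariant w hG hnorm h0 i V, hkill, zero_div, mul_zero]

/-- ★★ **`S₃` flat twirls transfer** (axis permutations `configPerm π` ↔ row permutations `P_π`, pairing `π ↦ π⁻¹`): if `Σ_π w_π f_{i+1}(P_π y) = f_{i+1}(y)` and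
`Σ_π w_π f_{l+1}(P_π y) = 0` (or vice versa) for `π⁻¹`-symmetric weights `w` — e.g. the `E`-doublet row projector `w_π = ⅓⟨p, D_E(π) p⟩/‖p‖²` for a rotation pair
inside an `E` doublet of `𝔥`, or `w ≡ 1/6` (an `A₁` channel against a channel of zero `S₃`-average) — then `PairSeparated (g_i) (g_l)` for an AL1 family with
`f_0 > 0`. [cite: Luscher1983, §2–§3] [cite: LuscherMunster1984, §4] -/
theorem pairSeparated_transplantObsL_of_S3Twirl (L : ℕ) (Λ R : ℝ) {f : Fin (k + 1) → ZM → ℝ} (hf : IsEigenFamily k f) (hpos : ∀ x, 0 < f 0 x)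
    (w : Equiv.Perm (Fin 3) → ℝ) (hw : ∀ σp, w σp⁻¹ = w σp) {i l : Fin k}
    (havg : ((∀ y, ∑ σp, w σp * f i.succ (LinearIsometryEquiv.piLpCongrLeft 2 ℝ ℝ (σp.prodCongr (Equiv.refl (Fin 3))) y) = f i.succ y) ∧
        (∀ y, ∑ σp, w σp * f l.succ (LinearIsometryEquiv.piLpCongrLeft 2 ℝ ℝ (σp.prodCongr (Equiv.refl (Fin 3))) y) = 0)) ∨
      ((∀ y, ∑ σp, w σp * f l.succ (LinearIsometryEquiv.piLpCongrLeft 2 ℝ ℝ (σp.prodCongr (Equiv.refl (Fin 3))) y) = f l.succ y) ∧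
        (∀ y, ∑ σp, w σp * f i.succ (LinearIsometryEquiv.piLpCongrLeft 2 ℝ ℝ (σp.prodCongr (Equiv.refl (Fin 3))) y) = 0))) :
    PairSeparated (transplantObsL L Λ R f i) (transplantObsL L Λ R f l) :=
  pairSeparated_transplantObsL_of_twirl L Λ R (fun σp V => configPerm σp V)
    (fun σp => LinearIsometryEquiv.piLpCongrLeft 2 ℝ ℝ (σp.prodCongr (Equiv.refl (Fin 3)))) (Equiv.inv (Equiv.Perm (Fin 3))) w
    (fun σp => isLiftSymmetry_configPerm σp) (fun σp V => configPerm_configPerm_inv_one_site σp V) (fun σp => hw σp)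
    (fun σp U => rootCoord_configPerm L (Λ / 2) σp U) (fun _ y => LinearIsometryEquiv.norm_map _ y)
    (fun σp y => groundState_rowPerm_of_isEigenFamily hf hpos σp y) havg

end Summit.QuantumFields.YangMills.Theorems.FemtoTransferGap.PolyakovLift

end
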